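import Literature.Barriers.Schanuel.NesterenkoModularScopeProp36Unmixed
import Literature.Barriers.Schanuel.NesterenkoModularScopeDeepPrimes
import Literature.Barriers.Schanuel.NesterenkoModularScopeInduction
import Literature.NumberTheory.Transcendental.NesterenkoHilbertBound
import Literature.NumberTheory.Transcendental.NesterenkoDegreeCut
import Literature.RingTheory.MvPolynomial.HomogeneousHilbertFunction
import Literature.NumberTheory.Transcendental.RoySmallValueFactors
import Mathlib.RingTheory.Lasker
import HarnessLib

/-!
# Barrier (Schanuel) `NesterenkoModularScope` — discharged: the chain construction of LNM 1752 Ch. 10 Prop. 3.6 (projectivised) and Nesterenko's Theorem 1.1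

Proofs only (no definitions, no named facts, nothing asserted). Discharge of the named fact
(barrier declaration) `Literature.Barriers.Schanuel.NesterenkoModularScope`
(`= nesterenko1996_thm_1_1`, `NesterenkoModularScope.lean`; Nesterenko 1996 = LNM 1752 Ch. 3
Theorem 1.1, p. 27: for `0 < |q| < 1`, `trdeg_ℚ ℚ(q, P(q), Q(q), R(q)) ≥ 3`).

The tree already reduces the barrier to **Proposition 3.6 of Ch. 10, projectivised over `ℚ` at the
levels `r = 2, 3, 4`** (`Transfer.nesterenkoModularScope_of_prop36`, `NesterenkoModularScopeInduction.lean`: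
Philippon's criterion, Props. 4.4, 4.7, 4.8, 4.11, 4.13 and Cors. 4.9, 4.10 of Ch. 3, Lemmas 2.2, 3.1,
3.4 of Ch. 3, the Ramanujan system, Mahler's theorem, the `D`-property Prop. 5.1 of Ch. 10 and the
induction of Ch. 10 §4 all being theorems of the tree). This file proves that proposition
(`Transfer.prop36`) by formalising the printed proof of Prop. 3.6 (LNM 1752 Ch. 10 §3,
pp. 157–159) with `m = 4` and no heights:

* `Transfer.exists_isLeastForm`, `irreducible_of_isLeastForm` — the least form `E ∈ 𝔭` (p. 157,
  "the polynomial `E` is obviously irreducible"); its degree is `≤ γ (deg 𝔭)^{1/(5−r)}` by Cor. 3.3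
  over the constant field (`Nesterenko.exists_form_degree_le_rpow_of_isPrime`, in the tree);
* `Transfer.primaryExponent_le_of_isLeastForm` — **(65)**: the exponents of the primary components
  of the chain ideals are bounded, from Prop. 4.7 1) of Ch. 3 and Lemma 3.2 over the constant field
  (`Nesterenko.exists_isHomogeneous_mem_ne_zero_of_isPrime`, in the tree) against the minimality of
  `deg E`;
* `Transfer.exists_notMem_forall_pow_mul_mem` — the auxiliary `H ∉ 𝔮` with `Gˡ H ∈ 𝔞_n` (p. 159);
* `Transfer.chain_step`, `chain_base`, `chain_iterate` — conditions 1)–3) of p. 158 and the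
  construction of `E_{n+1} = ∑ η_ν x₀^{r_ν} T^{j_ν} E_{i_ν}` (p. 159): the Leibniz argument
  (`NesterenkoCh10.apply_mem_of_forall_pow_mul_mem`, tree) with Lemma 3.4 (`Transfer.not_homTStable_of_deep`,
  tree) gives `T^{j_ν} E_{i_ν} ∉ 𝔮_ν`; prime avoidance in a `ℚ`-vector space
  (`Literature.RingTheory.MvPolynomial.exists_mem_forall_notMem_of_forall_not_le`); unmixedness of
  the new chain ideal at `𝔭` (`Transfer.isUnmixedOfRank_locP_ofList`, Macaulay, tree); the degree
  bound (64) by Lemma 3.5 1) (`Nesterenko.ideg_le_ideg_mul_of_sup_le`, tree);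
* `Transfer.false_of_chain_length`, `exists_homT_iterate_notMem` — "`n ≤ m − r`" and "`J_m ⊂ 𝔭` is
  impossible": some `Tʲ E ∉ 𝔭` with `j` bounded by an absolute constant;
* `Transfer.prop36` — `A = Tⁱ E ∈ 𝔭`, `C = TA ∉ 𝔭`, `B = C²`, (66)–(68);
* `NesterenkoModularScope_holds`, `nesterenko1996_thm_1_1_holds` — the discharge.

A sibling file is used (rather than an append to `NesterenkoModularScope.lean`) because the statement
file sits below all the proofs files in the import order.

## References

* [NesterenkoPhilippon2001] Yu. V. Nesterenko, P. Philippon (eds.), *Introduction to Algebraic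
  Independence Theory*, LNM 1752, Springer 2001: Ch. 3 (Yu. V. Nesterenko) Theorem 1.1 (p. 27),
  Prop. 4.7 (p. 39); Ch. 10 (Yu. V. Nesterenko) §3, Lemmas 3.2, 3.4, 3.5, Cor. 3.3, Prop. 3.6 and its
  proof, (62)–(68) (pp. 153–160), §4 (pp. 161–162).
* [Nesterenko1996SbMath] Yu. V. Nesterenko, *Modular functions and transcendence questions*,
  Sb. Math. 187 (1996) 1319–1348, Theorem 1.
-/

noncomputable section

open MvPolynomial
open Literature.NumberTheory.Transcendental Literature.NumberTheory.Transcendental.Nesterenko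

attribute [local instance] MvPolynomial.gradedAlgebra

namespace Literature.Barriers.Schanuel

namespace Transfer

/-! ### A depth element for an isolated primary component -/

/-- **The auxiliary `H` of LNM 1752 Ch. 10, p. 159** ("there exists a polynomial `H ∉ 𝔮` such that
`Gˡ H ∈ 𝔞_n` for any `G ∈ 𝔮`"): in a minimal primary decomposition `I = ⋂_{Q ∈ t} Q`, if the
radical of the component `Q₀` is minimal among the radicals of the components and `(√Q₀)ᵏ ⊆ Q₀`,
then some `H ∉ √Q₀` has `Gᵏ H ∈ I` for every `G ∈ √Q₀` (take `H` a product of elements of the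
other components outside `√Q₀`). [cite: NesterenkoPhilippon2001, Ch. 10, proof of Prop. 3.6 (p. 159)] -/
theorem exists_notMem_forall_pow_mul_mem {R : Type*} [CommRing R] {I : Ideal R}
    {t : Finset (Ideal R)} (ht : Submodule.IsMinimalPrimaryDecomposition I t) {Q₀ : Ideal R}
    (hQ₀ : Q₀ ∈ t) (hmin : ∀ Q ∈ t, Q.radical ≤ Q₀.radical → Q = Q₀) {k : ℕ}
    (hk : Q₀.radical ^ k ≤ Q₀) :
    ∃ H ∉ Q₀.radical, ∀ G ∈ Q₀.radical, G ^ k * H ∈ I := by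
  classical
  have hprime : Q₀.radical.IsPrime := Ideal.isPrime_radical (ht.primary hQ₀)
  have hpick : ∀ Q ∈ t.erase Q₀, ∃ h ∈ Q, h ∉ Q₀.radical := by
    intro Q hQ
    obtain ⟨hne, hQt⟩ := Finset.mem_erase.mp hQ
    by_contra hcon
    push Not at hcon
    refine hne (hmin Q hQt ?_)
    have hle : Q ≤ Q₀.radical := fun h hh => hcon h hh
    simpa only [hprime.radical] using Ideal.radical_mono hle
  choose! h hhQ hhrad using hpick
  refine ⟨∏ Q ∈ t.erase Q₀, h Q, ?_, fun G hG => ?_⟩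
  · exact Finset.prod_induction h (fun x => x ∉ Q₀.radical)
      (fun a b ha hb hab => (hprime.mem_or_mem hab).elim ha hb)
      (fun h1 => hprime.ne_top ((Ideal.eq_top_iff_one _).mpr h1)) fun Q hQ => hhrad Q hQ
  · have hmem : ∀ Q ∈ t, G ^ k * ∏ Q' ∈ t.erase Q₀, h Q' ∈ (id Q : Ideal R) := by
      intro Q hQ
      by_cases hQQ : Q = Q₀
      · subst hQQ
        exact Q.mul_mem_right _ (hk (Ideal.pow_mem_pow hG k))
      · have hQ' : Q ∈ t.erase Q₀ := Finset.mem_erase.mpr ⟨hQQ, hQ⟩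
        obtain ⟨u, hu⟩ := Finset.dvd_prod_of_mem h hQ'
        rw [hu]
        exact Q.mul_mem_left _ (Q.mul_mem_right _ (hhQ Q hQ'))
    have : G ^ k * ∏ Q' ∈ t.erase Q₀, h Q' ∈ t.inf id := (Submodule.mem_finsetInf).mpr hmem
    rwa [ht.inf_eq] at this

/-! ### The operator `T` and the variable `x₀` -/

/-- `T (x₀ⁿ G) = x₀ⁿ T G` (`T x₀ = 0`). [cite: NesterenkoPhilippon2001, Ch. 10 §3 (p. 155)] -/
theorem homT_X_zero_pow_mul (K : Type*) [Field K] (n : ℕ) (G : MvPolynomial (Fin 5) K) :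
    homT K (X 0 ^ n * G) = X 0 ^ n * homT K G := by
  rw [Derivation.leibniz, Derivation.leibniz_pow, homT_X_zero]
  simp

/-- `Tⁱ (x₀ⁿ G) = x₀ⁿ Tⁱ G`. [cite: NesterenkoPhilippon2001, Ch. 10 §3 (p. 155)] -/
theorem homT_iterate_X_zero_pow_mul (K : Type*) [Field K] (i n : ℕ) (G : MvPolynomial (Fin 5) K) :
    (homT K)^[i] (X 0 ^ n * G) = X 0 ^ n * (homT K)^[i] G := by
  induction i with
  | zero => rfl
  | succ i ih => rw [Function.iterate_succ_apply', ih, homT_X_zero_pow_mul, Function.iterate_succ_apply']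

/-- The generators `x₀ᵃ Tᵇ E`, `b ≤ β`, are stable under `T` up to raising `β`: all `Tⁱ`, `i ≤ l`,
of them lie in the ideal of the generators with `b ≤ β + l`. [folklore] -/
theorem homT_iterate_mem_span_gens (E : Rx 4) (β l : ℕ) :
    ∀ y ∈ Ideal.span {G : Rx 4 | ∃ a b : ℕ, b ≤ β ∧ G = X 0 ^ a * (homT ℚ)^[b] E}, ∀ i ≤ l,
      (homT ℚ)^[i] y ∈ Ideal.span {G : Rx 4 | ∃ a b : ℕ, b ≤ β + l ∧ G = X 0 ^ a * (homT ℚ)^[b] E} := by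
  refine NesterenkoCh10.iterate_apply_mem_of_span (homT ℚ) ?_
  rintro _ ⟨a, b, hb, rfl⟩ i hi
  refine Ideal.subset_span ⟨a, b + i, by omega, ?_⟩
  rw [homT_iterate_X_zero_pow_mul, ← Function.iterate_add_apply, Nat.add_comm]

/-! ### A form of least degree in a homogeneous prime -/

/-- **"The polynomial `E` is obviously irreducible"** (LNM 1752 Ch. 10, proof of Prop. 3.6, p. 157):
a non-zero form of least degree in a prime ideal of `ℚ[x̲]` is irreducible (divisors of forms are
forms). [cite: NesterenkoPhilippon2001, Ch. 10, proof of Prop. 3.6 (p. 157)] -/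
theorem irreducible_of_isLeastForm {𝔭 : Ideal (Rx 4)} (hprime : 𝔭.IsPrime) {E : Rx 4} {L : ℕ}
    (hE : E ∈ 𝔭) (hE0 : E ≠ 0) (hEL : E.IsHomogeneous L)
    (hmin : ∀ P ∈ 𝔭, P ≠ 0 → ∀ d, P.IsHomogeneous d → L ≤ d) : Irreducible E := by
  have key : ∀ a b : Rx 4, E = a * b → a ∈ 𝔭 → IsUnit b := by
    intro a b hab ha
    have ha0 : a ≠ 0 := by rintro rfl; exact hE0 (by rw [hab, zero_mul])
    have hb0 : b ≠ 0 := by rintro rfl; exact hE0 (by rw [hab, mul_zero])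
    have hahom := Roy2013.isHomogeneous_of_dvd hEL hE0 ⟨b, hab⟩
    have hbhom := Roy2013.isHomogeneous_of_dvd hEL hE0 ⟨a, hab.trans (mul_comm a b)⟩
    have hsum : a.totalDegree + b.totalDegree = L := by
      have h := hahom.mul hbhom
      rw [← hab] at h
      exact h.inj_right hEL hE0
    have hLa : L ≤ a.totalDegree := hmin a ha ha0 _ hahom
    have hb : b.totalDegree = 0 := by omega
    rw [totalDegree_eq_zero_iff_eq_C] at hb
    rw [hb]
    refine IsUnit.map C (Ne.isUnit ?_)
    intro h0
    exact hb0 (by rw [hb, h0, C_0])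
  refine irreducible_iff.mpr ⟨fun hu => hprime.ne_top (Ideal.eq_top_of_isUnit_mem _ hE hu), fun a b hab => ?_⟩
  rcases hprime.mem_or_mem (show a * b ∈ 𝔭 by rw [← hab]; exact hE) with ha | hb
  · exact Or.inr (key a b hab ha)
  · exact Or.inl (key b a (hab.trans (mul_comm a b)) hb)

/-- Hence `(E)` is a prime ideal (`ℚ[x̲]` is factorial). [folklore] -/
theorem isPrime_span_of_isLeastForm {𝔭 : Ideal (Rx 4)} (hprime : 𝔭.IsPrime) {E : Rx 4} {L : ℕ}
    (hE : E ∈ 𝔭) (hE0 : E ≠ 0) (hEL : E.IsHomogeneous L)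
    (hmin : ∀ P ∈ 𝔭, P ≠ 0 → ∀ d, P.IsHomogeneous d → L ≤ d) : (Ideal.span {E}).IsPrime :=
  (Ideal.span_singleton_prime hE0).mpr (irreducible_of_isLeastForm hprime hE hE0 hEL hmin).prime

/-- **A form of least degree** in a non-zero proper homogeneous ideal of `ℚ[x₀, …, x₄]`: a non-zero
`E ∈ 𝔭`, homogeneous of degree `L ≥ 1`, such that every non-zero form in `𝔭` has degree `≥ L`
("let `E` be a nonzero polynomial in `𝔭`, homogeneous, for which `deg E` attains its minimum",
LNM 1752 Ch. 10 p. 157, heights-free). [cite: NesterenkoPhilippon2001, Ch. 10, proof of Prop. 3.6 (p. 157)] -/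
theorem exists_isLeastForm {𝔭 : Ideal (Rx 4)} (hhom : 𝔭.IsHomogeneous (homogeneousSubmodule (Fin 5) ℚ))
    (hne : 𝔭 ≠ ⊥) (hnt : 𝔭 ≠ ⊤) :
    ∃ (E : Rx 4) (L : ℕ), E ∈ 𝔭 ∧ E ≠ 0 ∧ E.IsHomogeneous L ∧ 1 ≤ L ∧
      ∀ P ∈ 𝔭, P ≠ 0 → ∀ d, P.IsHomogeneous d → L ≤ d := by
  classical
  have hex : ∃ d, ∃ P ∈ 𝔭, P ≠ 0 ∧ P.IsHomogeneous d := by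
    obtain ⟨g, hg, n, hgn, hg0⟩ := exists_homogeneous_mem_ne_zero hhom hne
    exact ⟨n, g, hg, hg0, hgn⟩
  obtain ⟨E, hE, hE0, hEL⟩ := Nat.find_spec hex
  refine ⟨E, Nat.find hex, hE, hE0, hEL, ?_, fun P hP hP0 d hPd => Nat.find_min' hex ⟨P, hP, hP0, hPd⟩⟩
  by_contra h0
  have hL0 : Nat.find hex = 0 := by omega
  rw [hL0] at hEL
  have hdeg : E.totalDegree = 0 := hEL.totalDegree hE0
  rw [totalDegree_eq_zero_iff_eq_C] at hdeg
  refine hnt (Ideal.eq_top_of_isUnit_mem _ hE ?_)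
  rw [hdeg]
  refine IsUnit.map C (Ne.isUnit ?_)
  intro hc
  exact hE0 (by rw [hdeg, hc, C_0])

/-! ### (65): the exponents of the primary components are bounded -/

/-- **LNM 1752 Ch. 10, (65): `l ≤ 2λ a_n`** (heights-free, `m = 4`). Let `E ∈ 𝔭` be a least form,
of degree `L`, of the homogeneous prime `𝔭 ∌ x₀`, and `𝔲 ⊆ 𝔭` a homogeneous unmixed ideal of rank
`5 − k` (`1 ≤ k ≤ 4`) with `deg 𝔲 ≤ A Lᵏ`, all of whose associated primes lie in `𝔭`. Then every
component `Q` of a reduced primary decomposition of `𝔲` has exponent `l ≤ 6144 A`: otherwise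
`l · deg √Q ≤ deg 𝔲` (Prop. 4.7 1) of Ch. 3) makes `deg √Q < A Lᵏ / (6144 A)`, and Lemma 3.2 (over
the constant field) produces a non-zero form of degree `L − 1` in `√Q ⊆ 𝔭`, contradicting the
minimality of `L`. [cite: NesterenkoPhilippon2001, Ch. 10, proof of Prop. 3.6, (65) (p. 158); Ch. 3 Prop. 4.7 (p. 39)] -/
theorem primaryExponent_le_of_isLeastForm {𝔭 : Ideal (Rx 4)} (hx0 : (X 0 : Rx 4) ∉ 𝔭)
    {L : ℕ} (hL : 1 ≤ L) (hmin : ∀ P ∈ 𝔭, P ≠ 0 → ∀ d, P.IsHomogeneous d → L ≤ d)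
    {k : ℕ} (hk1 : 1 ≤ k) (hk4 : k ≤ 4) {u : Ideal (Rx 4)}
    (huhom : u.IsHomogeneous (homogeneousSubmodule (Fin 5) ℚ)) (hunm : IsUnmixedOfRank u (5 - k))
    {t : Finset (Ideal (Rx 4))} (ht : Submodule.IsMinimalPrimaryDecomposition u t)
    {A : ℕ} (hdeg : ideg u (5 - k) ≤ A * L ^ k) {Q : Ideal (Rx 4)} (hQ : Q ∈ t)
    (hQ𝔭 : Q.radical ≤ 𝔭) : primaryExponent Q ≤ 6144 * A := by
  classical
  obtain ⟨s, hs⟩ : ∃ s, s = 4 - k := ⟨_, rfl⟩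
  have hsk : 5 - k = s + 1 := by omega
  rw [hsk] at hunm hdeg
  have hqass : Q.radical ∈ u.associatedPrimes := by
    have h := ht.mem_associatedPrimes hQ
    rwa [Submodule.colon_univ] at h
  have hqprime : Q.radical.IsPrime := Ideal.isPrime_radical (ht.primary hQ)
  have hqdim : ringKrullDim (Rx 4 ⧸ Q.radical) = (s + 1 : ℕ) := hunm.2 _ hqass
  have hqhom : Q.radical.IsHomogeneous (homogeneousSubmodule (Fin 5) ℚ) :=
    (isHomogeneous_of_mem_isMinimalPrimaryDecomposition huhom hunm ht hQ).radical
  have hqunm : IsUnmixedOfRank Q.radical (s + 1) := isUnmixedOfRank_of_isPrime hqprime hqdim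
  have hx0q : (X 0 : Rx 4) ∉ Q.radical := fun h => hx0 (hQ𝔭 h)
  have hs1 : 1 ≤ s + 1 := by omega
  have hs4 : s + 1 ≤ 4 := by omega
  have hdq : 1 ≤ ideg Q.radical (s + 1) :=
    one_le_ideg_of_isPrime NesterenkoPhilippon2001_ch3_prop_4_4_holds hs1 hs4 hqprime hqhom hqunm
  -- Prop. 4.7 1): `l · deg √Q ≤ deg 𝔲`
  have h47 := (NesterenkoPhilippon2001_ch3_prop_4_7_holds 4 (s + 1) u hs1 hs4 huhom hunm t ht
    (fun _ => 1) (fun h => by simpa using congr_fun h 0)).1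
  have hl : primaryExponent Q * ideg Q.radical (s + 1) ≤ A * L ^ k := by
    calc primaryExponent Q * ideg Q.radical (s + 1)
        ≤ ∑ Q' ∈ t, primaryExponent Q' * ideg Q'.radical (s + 1) :=
          Finset.single_le_sum (f := fun Q' => primaryExponent Q' * ideg Q'.radical (s + 1))
            (fun _ _ => Nat.zero_le _) hQ
      _ = ideg u (s + 1) := h47
      _ ≤ A * L ^ k := hdeg
  by_contra hlt
  push Not at hlt
  have h1 : ideg Q.radical (s + 1) * (6144 * A) < A * L ^ k := by
    calc ideg Q.radical (s + 1) * (6144 * A)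
        < ideg Q.radical (s + 1) * primaryExponent Q := Nat.mul_lt_mul_of_pos_left hlt hdq
      _ = primaryExponent Q * ideg Q.radical (s + 1) := mul_comm _ _
      _ ≤ A * L ^ k := hl
  have hA : 1 ≤ A := by
    rcases Nat.eq_zero_or_pos A with h | h
    · rw [h, zero_mul] at h1; exact absurd h1 (Nat.not_lt_zero _)
    · exact h
  -- Lemma 3.2 over the constant field with `ν = L - 1`
  obtain ⟨ν, hν⟩ : ∃ ν, L = ν + 1 := ⟨L - 1, by omega⟩
  have hcount : ideg Q.radical (s + 1) * (s * ν + 1) ^ s < (ν + 4).choose ν := by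
    have h2 : (s * ν + 1) ^ s ≤ 4 ^ 4 * (ν + 1) ^ s := by
      have hs3 : s ≤ 3 := by omega
      calc (s * ν + 1) ^ s ≤ (4 * (ν + 1)) ^ s := Nat.pow_le_pow_left (by nlinarith) s
        _ = 4 ^ s * (ν + 1) ^ s := mul_pow _ _ _
        _ ≤ 4 ^ 4 * (ν + 1) ^ s :=
            Nat.mul_le_mul_right _ (Nat.pow_le_pow_right (by norm_num) (by omega))
    have h3 : (ν + 1) ^ 4 ≤ 24 * (ν + 4).choose ν := by
      have := GSec.pow_le_factorial_mul_choose ν 4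
      simpa [Nat.factorial] using this
    have hks : k + s = 4 := by omega
    refine Nat.lt_of_mul_lt_mul_right (a := 6144 * A) ?_
    calc ideg Q.radical (s + 1) * (s * ν + 1) ^ s * (6144 * A)
        = ideg Q.radical (s + 1) * (6144 * A) * (s * ν + 1) ^ s := by ring
      _ ≤ ideg Q.radical (s + 1) * (6144 * A) * (4 ^ 4 * (ν + 1) ^ s) := Nat.mul_le_mul_left _ h2
      _ < A * L ^ k * (4 ^ 4 * (ν + 1) ^ s) := Nat.mul_lt_mul_of_pos_right h1 (by positivity)
      _ = 4 ^ 4 * A * (ν + 1) ^ (k + s) := by rw [hν]; ring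
      _ = 4 ^ 4 * A * (ν + 1) ^ 4 := by rw [hks]
      _ ≤ 4 ^ 4 * A * (24 * (ν + 4).choose ν) := Nat.mul_le_mul_left _ h3
      _ = (ν + 4).choose ν * (6144 * A) := by ring
  obtain ⟨P, hPq, hPhom, hP0⟩ :=
    exists_isHomogeneous_mem_ne_zero_of_isPrime hqprime hqhom hqdim hx0q hcount
  have := hmin P (hQ𝔭 hPq) hP0 ν hPhom
  omega

/-! ### The chain step (conditions 1–3 of LNM 1752 Ch. 10 p. 158, and `E_{n+1}`) -/

/-- **The induction step of the chain construction** in the proof of Prop. 3.6 of LNM 1752 Ch. 10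
(pp. 157–159), projectivised over `ℚ` (`m = 4`, no heights). Data: a deep homogeneous prime `𝔭` of
rank `r` (`x₀ ∉ 𝔭`), a least form `E ∈ 𝔭` of degree `L`, and the standing assumption (to be
contradicted) that `Tʲ E ∈ 𝔭` for all `j ≤ N`. If `E₀ = E, …, E_{k−1} ∈ 𝔭` (`1 ≤ k ≤ 3`) are forms
of degrees in `[1, κL]` lying in the ideal of the `x₀ᵃ Tᵇ E`, `b ≤ β`, each `E_i` outside the
minimal primes `⊆ 𝔭` of `(E₀, …, E_{i−1})`, and the `𝔭`-component `𝔲 = (E₀, …, E_{k−1})_𝔭 ∩ ℚ[x̲]`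
(unmixed of rank `5 − k`, `isUnmixedOfRank_locP_ofList`) has `deg 𝔲 ≤ A Lᵏ`, then — provided
`N ≥ β + Λ`, `Λ = 6144 A + 1` — there is a form `E_k ∈ 𝔭` extending all of this with the constants
`(β + Λ, κ + Λ, A (κ + Λ))`. Construction as printed: for each associated prime `𝔮` of `𝔲` (exponent
`l ≤ Λ` by (65), `primaryExponent_le_of_isLeastForm`) some `Tʲ E_i ∉ 𝔮`, `j ≤ l` — otherwise
`T 𝔮 ⊆ 𝔮` by the Leibniz argument with the auxiliary `H` (`NesterenkoCh10.apply_mem_of_forall_pow_mul_mem`),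
contradicting Lemma 3.4 (`not_homTStable_of_deep`); then `E_k = ∑ η_ν x₀^{r_ν} T^{j_ν} E_{i_ν}`
avoids all these `𝔮` (a `ℚ`-vector space is not a finite union of proper subspaces), the new
component is unmixed of rank `4 − k` (Macaulay), and `deg 𝔲' ≤ deg 𝔲 · deg E_k` by Lemma 3.5 1)
(`ideg_le_ideg_mul_of_sup_le`). [cite: NesterenkoPhilippon2001, Ch. 10, proof of Prop. 3.6 (pp. 157–159)] -/
theorem chain_step {r : ℕ} {𝔭 : Ideal (Rx 4)} (hr1 : 1 ≤ r) (hr4 : r ≤ 4) (hprime : 𝔭.IsPrime)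
    (hhom : 𝔭.IsHomogeneous (homogeneousSubmodule (Fin 5) ℚ)) (hunm : IsUnmixedOfRank 𝔭 r)
    (hdeep : ((3 * r * ideg 𝔭 r : ℕ) : ℕ∞) ≤ ordI 𝔭 r) (hx0 : (X 0 : Rx 4) ∉ 𝔭)
    {E : Rx 4} {L : ℕ} (hE0 : E ≠ 0) (hL : 1 ≤ L)
    (hmin : ∀ P ∈ 𝔭, P ≠ 0 → ∀ d, P.IsHomogeneous d → L ≤ d)
    {N : ℕ} (hall : ∀ j ≤ N, (homT ℚ)^[j] E ∈ 𝔭)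
    {k : ℕ} (hk1 : 1 ≤ k) (hk3 : k ≤ 3) {Es : List (Rx 4)} {β κ A : ℕ}
    (hlen : Es.length = k) (hmem : ∀ x ∈ Es, x ∈ 𝔭) (hEmem : E ∈ Es)
    (hhomEs : ∀ x ∈ Es, ∃ d, 1 ≤ d ∧ d ≤ κ * L ∧ x.IsHomogeneous d)
    (hgen : ∀ x ∈ Es, x ∈ Ideal.span {G : Rx 4 | ∃ a b : ℕ, b ≤ β ∧ G = X 0 ^ a * (homT ℚ)^[b] E})
    (hav : ∀ (L₁ : List (Rx 4)) (y : Rx 4) (L₂ : List (Rx 4)), Es = L₁ ++ y :: L₂ →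
      ∀ 𝔭' ∈ (Ideal.ofList L₁).minimalPrimes, 𝔭' ≤ 𝔭 → y ∉ 𝔭')
    (hdegu : ideg (locP 𝔭 hprime (Ideal.ofList Es)) (5 - k) ≤ A * L ^ k) (hA : 1 ≤ A)
    (hN : β + (6144 * A + 1) ≤ N) :
    ∃ E' : Rx 4,
      (Es ++ [E']).length = k + 1 ∧ (∀ x ∈ Es ++ [E'], x ∈ 𝔭) ∧ E ∈ Es ++ [E'] ∧
      (∀ x ∈ Es ++ [E'], ∃ d, 1 ≤ d ∧ d ≤ (κ + (6144 * A + 1)) * L ∧ x.IsHomogeneous d) ∧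
      (∀ x ∈ Es ++ [E'], x ∈ Ideal.span {G : Rx 4 | ∃ a b : ℕ, b ≤ β + (6144 * A + 1) ∧
          G = X 0 ^ a * (homT ℚ)^[b] E}) ∧
      (∀ (L₁ : List (Rx 4)) (y : Rx 4) (L₂ : List (Rx 4)), Es ++ [E'] = L₁ ++ y :: L₂ →
        ∀ 𝔭' ∈ (Ideal.ofList L₁).minimalPrimes, 𝔭' ≤ 𝔭 → y ∉ 𝔭') ∧
      ideg (locP 𝔭 hprime (Ideal.ofList (Es ++ [E']))) (5 - (k + 1)) ≤
          A * (κ + (6144 * A + 1)) * L ^ (k + 1) ∧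
      1 ≤ A * (κ + (6144 * A + 1)) := by
  classical
  -- notation
  obtain ⟨Λ, hΛ⟩ : ∃ Λ : ℕ, Λ = 6144 * A + 1 := ⟨_, rfl⟩
  rw [← hΛ] at hN ⊢
  have ha𝔭 : Ideal.ofList Es ≤ 𝔭 := Ideal.span_le.mpr fun x hx => hmem x hx
  -- the component `𝔲` at `𝔭`: unmixed of rank `5 - k`, associated primes = minimal primes `⊆ 𝔭`
  obtain ⟨hunmu, hassu⟩ := isUnmixedOfRank_locP_ofList hprime hmem hav
  have h5k : 4 + 1 - Es.length = 5 - k := by rw [hlen]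
  rw [h5k] at hunmu
  have hahom : (Ideal.ofList Es).IsHomogeneous (homogeneousSubmodule (Fin 5) ℚ) := by
    refine Ideal.homogeneous_span _ _ fun x hx => ?_
    obtain ⟨d, -, -, hxd⟩ := hhomEs x hx
    exact ⟨d, hxd⟩
  have huhom : (locP 𝔭 hprime (Ideal.ofList Es)).IsHomogeneous (homogeneousSubmodule (Fin 5) ℚ) :=
    isHomogeneous_locP hprime hahom
  obtain ⟨t, ht⟩ : ∃ t : Finset (Ideal (Rx 4)),
      Submodule.IsMinimalPrimaryDecomposition (locP 𝔭 hprime (Ideal.ofList Es)) t :=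
    Submodule.IsLasker.exists_isMinimalPrimaryDecomposition (Submodule.isLasker (Rx 4) (Rx 4)) _
  have hrad : ∀ Q ∈ t, Q.radical ∈ (locP 𝔭 hprime (Ideal.ofList Es)).associatedPrimes := fun Q hQ => by
    have h := ht.mem_associatedPrimes hQ
    rwa [Submodule.colon_univ] at h
  have hQmin : ∀ Q ∈ t, Q.radical ∈ (Ideal.ofList Es).minimalPrimes ∧ Q.radical ≤ 𝔭 := fun Q hQ =>
    (hassu _).mp (hrad Q hQ)
  have hQprime : ∀ Q ∈ t, Q.radical.IsPrime := fun Q hQ => Ideal.isPrime_radical (ht.primary hQ)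
  have hQhom : ∀ Q ∈ t, Q.radical.IsHomogeneous (homogeneousSubmodule (Fin 5) ℚ) := fun Q hQ =>
    Literature.RingTheory.MvPolynomial.isHomogeneous_of_mem_minimalPrimes hahom (hQmin Q hQ).1
  have hx0Q : ∀ Q ∈ t, (X 0 : Rx 4) ∉ Q.radical := fun Q hQ h => hx0 ((hQmin Q hQ).2 h)
  have hEa : E ∈ Ideal.ofList Es := Ideal.subset_span hEmem
  have hQne : ∀ Q ∈ t, Q.radical ≠ ⊥ := fun Q hQ h => hE0 (by
    have : E ∈ Q.radical := (hQmin Q hQ).1.1.2 hEa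
    rwa [h, Ideal.mem_bot] at this)
  have hassrad : ∀ P ∈ (locP 𝔭 hprime (Ideal.ofList Es)).associatedPrimes, ∃ Q ∈ t, Q.radical = P := by
    intro P hP
    rw [← ht.image_radical_eq_associated_primes] at hP
    obtain ⟨Q, hQ, hQP⟩ := hP
    exact ⟨Q, hQ, by simpa only [Submodule.colon_univ] using hQP⟩
  -- (65): exponents bounded by `6144 A < Λ`
  have hl : ∀ Q ∈ t, primaryExponent Q ≤ 6144 * A := fun Q hQ =>
    primaryExponent_le_of_isLeastForm hx0 hL hmin hk1 (by omega) huhom hunmu ht hdegu hQ (hQmin Q hQ).2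
  -- radicals of distinct components are incomparable (all are minimal over `(E₀, …, E_{k-1})`)
  have htmin : ∀ Q₀ ∈ t, ∀ Q ∈ t, Q.radical ≤ Q₀.radical → Q = Q₀ := by
    intro Q₀ hQ₀ Q hQ hle
    have haQ : Ideal.ofList Es ≤ Q.radical :=
      ((le_locP hprime _).trans (ht.inf_eq.symm.le.trans (Finset.inf_le hQ))).trans Ideal.le_radical
    have heq : Q.radical = Q₀.radical :=
      le_antisymm hle ((hQmin Q₀ hQ₀).1.2 ⟨hQprime Q hQ, haQ⟩ hle)
    exact Submodule.IsMinimalPrimaryDecomposition.injOn _ t ht hQ hQ₀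
      (by simpa only [Submodule.colon_univ] using heq)
  -- for each component some `Tʲ E_i ∉ √Q`, `j ≤ l` (Leibniz + Lemma 3.4)
  have hij : ∀ Q ∈ t, ∃ x ∈ Es, ∃ j : ℕ, j ≤ primaryExponent Q ∧ (homT ℚ)^[j] x ∉ Q.radical := by
    intro Q hQ
    by_contra hcon
    push Not at hcon
    obtain ⟨H, hH, hGH⟩ := exists_notMem_forall_pow_mul_mem ht hQ (htmin Q hQ)
      (radical_pow_primaryExponent_le Q)
    obtain ⟨s, hs, hsu⟩ := exists_mul_locP_le hprime (Ideal.ofList Es)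
    have hiter : ∀ y ∈ Ideal.ofList Es, ∀ j ≤ primaryExponent Q, (homT ℚ)^[j] y ∈ Q.radical :=
      NesterenkoCh10.iterate_apply_mem_of_span (homT ℚ) (S := {x | x ∈ Es}) fun g hg j hj => hcon g hg j hj
    have hsH : s * H ∉ Q.radical := fun h =>
      ((hQprime Q hQ).mem_or_mem h).elim (fun hs' => hs ((hQmin Q hQ).2 hs')) hH
    have hstable : ∀ G ∈ Q.radical, homT ℚ G ∈ Q.radical := fun G hG =>
      NesterenkoCh10.apply_mem_of_forall_pow_mul_mem (homT ℚ) (hQprime Q hQ)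
        (NesterenkoCh10.natCast_factorial_notMem (hQprime Q hQ).ne_top _)
        (fun y hy => hiter y hy _ le_rfl) hsH
        (fun G' hG' => by
          have := hsu _ (hGH G' hG')
          rwa [mul_left_comm] at this) hG
    exact not_homTStable_of_deep hr1 hr4 hprime hhom hunm hdeep (hQhom Q hQ) (hQne Q hQ) (hQmin Q hQ).2
      hstable
  choose! x hxEs j hjle hjnot using hij
  have hdx : ∀ Q ∈ t, ∃ d, 1 ≤ d ∧ d ≤ κ * L ∧ (x Q).IsHomogeneous d := fun Q hQ => hhomEs _ (hxEs Q hQ)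
  choose! dx h1dx hdxle hdxhom using hdx
  -- the common degree `D = κ L + Λ` of the padded candidates
  obtain ⟨D, hD⟩ : ∃ D : ℕ, D = κ * L + Λ := ⟨_, rfl⟩
  have hfit : ∀ Q ∈ t, dx Q + j Q ≤ D := fun Q hQ => by
    have h1 := hjle Q hQ; have h2 := hl Q hQ; have h3 := hdxle Q hQ
    omega
  have hFhom : ∀ Q ∈ t, (X 0 ^ (D - (dx Q + j Q)) * (homT ℚ)^[j Q] (x Q) : Rx 4).IsHomogeneous D := by
    intro Q hQ
    have h1 : ((X 0 : Rx 4) ^ (D - (dx Q + j Q))).IsHomogeneous (D - (dx Q + j Q)) := by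
      simpa using (isHomogeneous_X ℚ (0 : Fin 5)).pow (D - (dx Q + j Q))
    have h2 : ((homT ℚ)^[j Q] (x Q)).IsHomogeneous (dx Q + j Q) :=
      isHomogeneous_homT_iterate ℚ (hdxhom Q hQ) (j Q)
    have := h1.mul h2
    rwa [Nat.sub_add_cancel (hfit Q hQ)] at this
  have hFnot : ∀ Q ∈ t, (X 0 ^ (D - (dx Q + j Q)) * (homT ℚ)^[j Q] (x Q) : Rx 4) ∉ Q.radical :=
    fun Q hQ h => ((hQprime Q hQ).mem_or_mem h).elim
      (fun h' => hx0Q Q hQ ((hQprime Q hQ).mem_of_pow_mem _ h')) (hjnot Q hQ)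
  have hFgen : ∀ Q ∈ t, (X 0 ^ (D - (dx Q + j Q)) * (homT ℚ)^[j Q] (x Q) : Rx 4) ∈
      Ideal.span {G : Rx 4 | ∃ a b : ℕ, b ≤ β + Λ ∧ G = X 0 ^ a * (homT ℚ)^[b] E} := fun Q hQ =>
    Ideal.mul_mem_left _ _ (homT_iterate_mem_span_gens E β Λ _ (hgen _ (hxEs Q hQ)) _
      ((hjle Q hQ).trans ((hl Q hQ).trans (by omega))))
  -- prime avoidance in the `ℚ`-span of the candidates
  obtain ⟨E', hE'V, hE'not⟩ :=
    Literature.RingTheory.MvPolynomial.exists_mem_forall_notMem_of_forall_not_le (K := ℚ)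
      (Submodule.span ℚ ((fun Q => (X 0 ^ (D - (dx Q + j Q)) * (homT ℚ)^[j Q] (x Q) : Rx 4)) ''
        (t : Set (Ideal (Rx 4)))))
      (t.image fun Q => (Q.radical).restrictScalars ℚ) (by
        intro W hW hle
        obtain ⟨Q, hQ, rfl⟩ := Finset.mem_image.mp hW
        exact hFnot Q hQ (hle (Submodule.subset_span ⟨Q, hQ, rfl⟩)))
  have hE'notQ : ∀ Q ∈ t, E' ∉ Q.radical := fun Q hQ h =>
    hE'not _ (Finset.mem_image_of_mem _ hQ) h
  have hE'hom : E'.IsHomogeneous D := by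
    have hle : Submodule.span ℚ ((fun Q => (X 0 ^ (D - (dx Q + j Q)) * (homT ℚ)^[j Q] (x Q) : Rx 4)) ''
        (t : Set (Ideal (Rx 4)))) ≤ homogeneousSubmodule (Fin 5) ℚ D :=
      Submodule.span_le.mpr (by rintro _ ⟨Q, hQ, rfl⟩; exact hFhom Q hQ)
    exact hle hE'V
  have hE'gen : E' ∈ Ideal.span {G : Rx 4 | ∃ a b : ℕ, b ≤ β + Λ ∧ G = X 0 ^ a * (homT ℚ)^[b] E} := by
    have hle : Submodule.span ℚ ((fun Q => (X 0 ^ (D - (dx Q + j Q)) * (homT ℚ)^[j Q] (x Q) : Rx 4)) ''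
        (t : Set (Ideal (Rx 4)))) ≤
        (Ideal.span {G : Rx 4 | ∃ a b : ℕ, b ≤ β + Λ ∧ G = X 0 ^ a * (homT ℚ)^[b] E}).restrictScalars ℚ :=
      Submodule.span_le.mpr (by rintro _ ⟨Q, hQ, rfl⟩; exact hFgen Q hQ)
    exact hle hE'V
  have hgen𝔭 : Ideal.span {G : Rx 4 | ∃ a b : ℕ, b ≤ β + Λ ∧ G = X 0 ^ a * (homT ℚ)^[b] E} ≤ 𝔭 := by
    refine Ideal.span_le.mpr ?_
    rintro _ ⟨a', b, hb, rfl⟩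
    exact 𝔭.mul_mem_left _ (hall b (by omega))
  have hE'𝔭 : E' ∈ 𝔭 := hgen𝔭 hE'gen
  -- the new list
  have hlen' : (Es ++ [E']).length = k + 1 := by simp [hlen]
  have hmem' : ∀ y ∈ Es ++ [E'], y ∈ 𝔭 := by
    intro y hy
    rcases List.mem_append.mp hy with hy | hy
    · exact hmem y hy
    · rw [List.mem_singleton] at hy
      rw [hy]
      exact hE'𝔭
  have hhom' : ∀ y ∈ Es ++ [E'], ∃ d, 1 ≤ d ∧ d ≤ (κ + Λ) * L ∧ y.IsHomogeneous d := by
    intro y hy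
    rcases List.mem_append.mp hy with hy | hy
    · obtain ⟨d, h1, h2, h3⟩ := hhomEs y hy
      exact ⟨d, h1, h2.trans (Nat.mul_le_mul_right _ (Nat.le_add_right _ _)), h3⟩
    · rw [List.mem_singleton] at hy
      rw [hy]
      refine ⟨D, by omega, ?_, hE'hom⟩
      rw [hD, add_mul]
      exact Nat.add_le_add_left (by simpa using Nat.mul_le_mul_left Λ hL) _
  have hgen' : ∀ y ∈ Es ++ [E'],
      y ∈ Ideal.span {G : Rx 4 | ∃ a b : ℕ, b ≤ β + Λ ∧ G = X 0 ^ a * (homT ℚ)^[b] E} := by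
    intro y hy
    rcases List.mem_append.mp hy with hy | hy
    · refine Ideal.span_mono ?_ (hgen y hy)
      rintro G ⟨a', b, hb, hG⟩
      exact ⟨a', b, by omega, hG⟩
    · rw [List.mem_singleton] at hy
      rw [hy]
      exact hE'gen
  have hav' : ∀ (L₁ : List (Rx 4)) (y : Rx 4) (L₂ : List (Rx 4)), Es ++ [E'] = L₁ ++ y :: L₂ →
      ∀ 𝔭' ∈ (Ideal.ofList L₁).minimalPrimes, 𝔭' ≤ 𝔭 → y ∉ 𝔭' := by
    intro L₁ y L₂ hdec 𝔭' h𝔭' h𝔭'le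
    rcases List.eq_nil_or_concat L₂ with hL₂ | ⟨M, z, hL₂⟩
    · subst hL₂
      obtain ⟨hEs, hy⟩ := List.append_inj' hdec rfl
      have hy' : E' = y := by simpa using hy
      subst hEs
      rw [← hy']
      obtain ⟨Q, hQ, hQ𝔭'⟩ := hassrad 𝔭' ((hassu 𝔭').mpr ⟨h𝔭', h𝔭'le⟩)
      rw [← hQ𝔭']
      exact hE'notQ Q hQ
    · subst hL₂
      have hdec' : Es ++ [E'] = (L₁ ++ y :: M) ++ [z] := by rw [hdec]; simp
      obtain ⟨hEs, -⟩ := List.append_inj' hdec' rfl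
      exact hav L₁ y M hEs 𝔭' h𝔭' h𝔭'le
  -- the degree of the new component (Lemma 3.5 1))
  have hdeg' : ideg (locP 𝔭 hprime (Ideal.ofList (Es ++ [E']))) (5 - (k + 1)) ≤ A * (κ + Λ) * L ^ (k + 1) := by
    obtain ⟨hunmu', -⟩ := isUnmixedOfRank_locP_ofList hprime hmem' hav'
    have h4k : 4 + 1 - (Es ++ [E']).length = 4 - k := by rw [hlen']; omega
    rw [h4k] at hunmu'
    have ha'hom : (Ideal.ofList (Es ++ [E'])).IsHomogeneous (homogeneousSubmodule (Fin 5) ℚ) := by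
      refine Ideal.homogeneous_span _ _ fun y hy => ?_
      obtain ⟨d, -, -, hyd⟩ := hhom' y hy
      exact ⟨d, hyd⟩
    have hu'hom := isHomogeneous_locP hprime ha'hom
    have hsk : 5 - k = 4 - k + 1 := by omega
    have hunmu1 : IsUnmixedOfRank (locP 𝔭 hprime (Ideal.ofList Es)) (4 - k + 1) := by
      rw [← hsk]; exact hunmu
    have hQI : ∀ P ∈ (locP 𝔭 hprime (Ideal.ofList Es)).associatedPrimes, E' ∉ P := fun P hP => by
      obtain ⟨Q, hQ, rfl⟩ := hassrad P hP
      exact hE'notQ Q hQ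
    have hle : locP 𝔭 hprime (Ideal.ofList Es) ⊔ Ideal.span {E'} ≤
        locP 𝔭 hprime (Ideal.ofList (Es ++ [E'])) := by
      refine sup_le (locP_mono hprime (Ideal.span_mono fun y (hy : y ∈ Es) => ?_)) ?_
      · exact (List.mem_append_left [E'] hy : y ∈ Es ++ [E'])
      · rw [Ideal.span_singleton_le_iff_mem]
        exact le_locP hprime _ (Ideal.subset_span (by simp))
    have hcut := ideg_le_ideg_mul_of_sup_le (m := 4) (s := 4 - k) (by omega) (by omega) huhom hunmu1
      hu'hom hunmu' hE'hom (by omega) hQI hle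
    have h5 : 5 - (k + 1) = 4 - k := by omega
    rw [h5]
    calc ideg (locP 𝔭 hprime (Ideal.ofList (Es ++ [E']))) (4 - k)
        ≤ ideg (locP 𝔭 hprime (Ideal.ofList Es)) (4 - k + 1) * D := hcut
      _ ≤ A * L ^ k * D := by rw [← hsk]; exact Nat.mul_le_mul_right _ hdegu
      _ ≤ A * L ^ k * ((κ + Λ) * L) := by
          refine Nat.mul_le_mul_left _ ?_
          rw [hD, add_mul]
          exact Nat.add_le_add_left (by simpa using Nat.mul_le_mul_left Λ hL) _
      _ = A * (κ + Λ) * L ^ (k + 1) := by ring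
  refine ⟨E', hlen', hmem', List.mem_append_left _ hEmem, hhom', hgen', hav', hdeg', ?_⟩
  exact Nat.one_le_iff_ne_zero.mpr (Nat.mul_ne_zero (by omega) (by omega))

/-! ### The chain: base, iteration, and the contradiction -/

/-- **The base of the chain**: `E₀ = E` ("setting `E₀ = E` … the conditions 1–3 are satisfied
with `0` in place of `n`", p. 158): `(E)` is prime, so its `𝔭`-component is `(E)` itself, of
degree `L`. [cite: NesterenkoPhilippon2001, Ch. 10, proof of Prop. 3.6 (p. 158)] -/
theorem chain_base {𝔭 : Ideal (Rx 4)} (hprime : 𝔭.IsPrime) {E : Rx 4} {L : ℕ} (hE : E ∈ 𝔭)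
    (hE0 : E ≠ 0) (hEL : E.IsHomogeneous L) (hL : 1 ≤ L)
    (hmin : ∀ P ∈ 𝔭, P ≠ 0 → ∀ d, P.IsHomogeneous d → L ≤ d) :
    ([E] : List (Rx 4)).length = 1 ∧ (∀ x ∈ ([E] : List (Rx 4)), x ∈ 𝔭) ∧ E ∈ ([E] : List (Rx 4)) ∧
      (∀ x ∈ ([E] : List (Rx 4)), ∃ d, 1 ≤ d ∧ d ≤ 1 * L ∧ x.IsHomogeneous d) ∧
      (∀ x ∈ ([E] : List (Rx 4)),
        x ∈ Ideal.span {G : Rx 4 | ∃ a b : ℕ, b ≤ 0 ∧ G = X 0 ^ a * (homT ℚ)^[b] E}) ∧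
      (∀ (L₁ : List (Rx 4)) (y : Rx 4) (L₂ : List (Rx 4)), [E] = L₁ ++ y :: L₂ →
        ∀ 𝔭' ∈ (Ideal.ofList L₁).minimalPrimes, 𝔭' ≤ 𝔭 → y ∉ 𝔭') ∧
      ideg (locP 𝔭 hprime (Ideal.ofList [E])) (5 - 1) ≤ 1 * L ^ 1 ∧ 1 ≤ 1 := by
  refine ⟨rfl, fun x hx => ?_, List.mem_singleton_self E, fun x hx => ?_, fun x hx => ?_, ?_, ?_, le_rfl⟩
  · rw [List.mem_singleton] at hx
    rw [hx]; exact hE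
  · rw [List.mem_singleton] at hx
    rw [hx]
    exact ⟨L, hL, by omega, hEL⟩
  · rw [List.mem_singleton] at hx
    rw [hx]
    exact Ideal.subset_span ⟨0, 0, le_rfl, by simp⟩
  · intro L₁ y L₂ hdec 𝔭' h𝔭' _
    cases L₁ with
    | nil =>
      simp only [List.nil_append, List.cons.injEq] at hdec
      obtain ⟨rfl, -⟩ := hdec
      have hbot : Ideal.ofList ([] : List (Rx 4)) = ⊥ := by simp [Ideal.ofList]
      rw [hbot, Ideal.minimalPrimes_eq_subsingleton_self] at h𝔭'
      rw [Set.mem_singleton_iff] at h𝔭'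
      rw [h𝔭', Ideal.mem_bot]
      exact hE0
    | cons w L₁ =>
      simp only [List.cons_append, List.cons.injEq] at hdec
      obtain ⟨-, h⟩ := hdec
      cases L₁ <;> simp at h
  · have hspan : Ideal.ofList ([E] : List (Rx 4)) = Ideal.span {E} := by
      simp [Ideal.ofList, Set.setOf_eq_eq_singleton]
    have hEprime := isPrime_span_of_isLeastForm hprime hE hE0 hEL hmin
    rw [hspan, locP_eq_self_of_isPrime hprime hEprime ((Ideal.span_singleton_le_iff_mem _).mpr hE),
      show (5 - 1 : ℕ) = 4 from rfl, ideg_span_singleton hE0 hEL hL]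
    simp

/-- **Iterating the chain**: under the standing assumption `Tʲ E ∈ 𝔭` (`j ≤ N`, `N` large in terms
of absolute constants), chains `E₀ = E, …, E_n` of every length `n + 1 ≤ 4` exist, with constants
depending only on `n`. [cite: NesterenkoPhilippon2001, Ch. 10, proof of Prop. 3.6 (pp. 157–159)] -/
theorem chain_iterate (n : ℕ) (hn : n ≤ 3) : ∃ N₀ β κ A : ℕ, 1 ≤ A ∧
    ∀ (r : ℕ) (𝔭 : Ideal (Rx 4)) (hr1 : 1 ≤ r) (hr4 : r ≤ 4) (hprime : 𝔭.IsPrime)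
      (hhom : 𝔭.IsHomogeneous (homogeneousSubmodule (Fin 5) ℚ)) (hunm : IsUnmixedOfRank 𝔭 r)
      (hdeep : ((3 * r * ideg 𝔭 r : ℕ) : ℕ∞) ≤ ordI 𝔭 r) (hx0 : (X 0 : Rx 4) ∉ 𝔭)
      (E : Rx 4) (L : ℕ) (hE : E ∈ 𝔭) (hE0 : E ≠ 0) (hEL : E.IsHomogeneous L) (hL : 1 ≤ L)
      (hmin : ∀ P ∈ 𝔭, P ≠ 0 → ∀ d, P.IsHomogeneous d → L ≤ d) (N : ℕ) (hN : N₀ ≤ N)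
      (hall : ∀ j ≤ N, (homT ℚ)^[j] E ∈ 𝔭),
      ∃ Es : List (Rx 4), Es.length = n + 1 ∧ (∀ x ∈ Es, x ∈ 𝔭) ∧ E ∈ Es ∧
        (∀ x ∈ Es, ∃ d, 1 ≤ d ∧ d ≤ κ * L ∧ x.IsHomogeneous d) ∧
        (∀ x ∈ Es, x ∈ Ideal.span {G : Rx 4 | ∃ a b : ℕ, b ≤ β ∧ G = X 0 ^ a * (homT ℚ)^[b] E}) ∧
        (∀ (L₁ : List (Rx 4)) (y : Rx 4) (L₂ : List (Rx 4)), Es = L₁ ++ y :: L₂ →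
          ∀ 𝔭' ∈ (Ideal.ofList L₁).minimalPrimes, 𝔭' ≤ 𝔭 → y ∉ 𝔭') ∧
        ideg (locP 𝔭 hprime (Ideal.ofList Es)) (5 - (n + 1)) ≤ A * L ^ (n + 1) := by
  induction n with
  | zero =>
    refine ⟨0, 0, 1, 1, le_rfl, ?_⟩
    intro r 𝔭 hr1 hr4 hprime hhom hunm hdeep hx0 E L hE hE0 hEL hL hmin N hN hall
    obtain ⟨h1, h2, h3, h4, h5, h6, h7, -⟩ := chain_base hprime hE hE0 hEL hL hmin
    exact ⟨[E], h1, h2, h3, h4, h5, h6, h7⟩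
  | succ n ih =>
    obtain ⟨N₀, β, κ, A, hA, h⟩ := ih (by omega)
    refine ⟨max N₀ (β + (6144 * A + 1)), β + (6144 * A + 1), κ + (6144 * A + 1),
      A * (κ + (6144 * A + 1)), Nat.one_le_iff_ne_zero.mpr (Nat.mul_ne_zero (by omega) (by omega)), ?_⟩
    intro r 𝔭 hr1 hr4 hprime hhom hunm hdeep hx0 E L hE hE0 hEL hL hmin N hN hall
    obtain ⟨Es, hlen, hmem, hEmem, hhomEs, hgen, hav, hdegu⟩ :=
      h r 𝔭 hr1 hr4 hprime hhom hunm hdeep hx0 E L hE hE0 hEL hL hmin N ((le_max_left _ _).trans hN) hall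
    obtain ⟨E', h1, h2, h3, h4, h5, h6, h7, -⟩ := chain_step hr1 hr4 hprime hhom hunm hdeep hx0 hE0 hL hmin
      hall (k := n + 1) (by omega) (by omega) hlen hmem hEmem hhomEs hgen hav hdegu hA
      ((le_max_right _ _).trans hN)
    exact ⟨Es ++ [E'], h1, h2, h3, h4, h5, h6, h7⟩

/-- **A chain of length `6 − r` inside `𝔭` is impossible** ("`n ≤ m − r`", p. 158): its minimal
primes `⊆ 𝔭` would have dimension `r − 2 < dim 𝔭 = r − 1`. [cite: NesterenkoPhilippon2001, Ch. 10, proof of Prop. 3.6 (p. 158)] -/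
theorem false_of_chain_length {r : ℕ} {𝔭 : Ideal (Rx 4)} (hr2 : 2 ≤ r) (hprime : 𝔭.IsPrime)
    (hunm : IsUnmixedOfRank 𝔭 r) {Es : List (Rx 4)} (hlen : Es.length = 6 - r)
    (hmem : ∀ x ∈ Es, x ∈ 𝔭)
    (hav : ∀ (L₁ : List (Rx 4)) (y : Rx 4) (L₂ : List (Rx 4)), Es = L₁ ++ y :: L₂ →
      ∀ 𝔭' ∈ (Ideal.ofList L₁).minimalPrimes, 𝔭' ≤ 𝔭 → y ∉ 𝔭') : False := by
  haveI := hprime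
  have ha𝔭 : Ideal.ofList Es ≤ 𝔭 := Ideal.span_le.mpr fun x hx => hmem x hx
  obtain ⟨P, hP, hP𝔭⟩ := Ideal.exists_minimalPrimes_le ha𝔭
  obtain ⟨hunmu, hassu⟩ := isUnmixedOfRank_locP_ofList hprime hmem hav
  have hdimP : ringKrullDim (Rx 4 ⧸ P) = (4 + 1 - Es.length : ℕ) := hunmu.2 P ((hassu P).mpr ⟨hP, hP𝔭⟩)
  have hdim𝔭 : ringKrullDim (Rx 4 ⧸ 𝔭) = r := hunm.2 𝔭 (self_mem_associatedPrimes hprime)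
  have hle : ringKrullDim (Rx 4 ⧸ 𝔭) ≤ ringKrullDim (Rx 4 ⧸ P) :=
    ringKrullDim_le_of_surjective (Ideal.Quotient.factor hP𝔭) (Ideal.Quotient.factor_surjective hP𝔭)
  rw [hdim𝔭, hdimP, hlen] at hle
  have key : ∀ a b : ℕ, (a : WithBot ℕ∞) ≤ (b : WithBot ℕ∞) → a ≤ b := fun a b h => by
    rw [← WithBot.coe_natCast, ← WithBot.coe_natCast] at h
    exact_mod_cast WithBot.coe_le_coe.mp h
  have h := key _ _ hle
  omega

/-- **The `T`-orbit of a least form leaves a deep prime within boundedly many steps** ("thus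
`J_{n+1}` is not contained in `𝔭` … there exists an index `i`, `0 ≤ i < c_m − 1`, such that
`A = Tⁱ E ∈ 𝔭` but `C = TA ∉ 𝔭`", p. 159), with a bound `N` depending on nothing: for every deep
homogeneous prime `𝔭` of rank `2 ≤ r ≤ 4` and every least form `E` of `𝔭`, some `Tʲ E ∉ 𝔭`,
`j ≤ N`. [cite: NesterenkoPhilippon2001, Ch. 10, proof of Prop. 3.6 (pp. 157–159)] -/
theorem exists_homT_iterate_notMem : ∃ N : ℕ, ∀ (r : ℕ) (𝔭 : Ideal (Rx 4)), 2 ≤ r → r ≤ 4 →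
    𝔭.IsPrime → 𝔭.IsHomogeneous (homogeneousSubmodule (Fin 5) ℚ) → IsUnmixedOfRank 𝔭 r →
    ((3 * r * ideg 𝔭 r : ℕ) : ℕ∞) ≤ ordI 𝔭 r →
    ∀ (E : Rx 4) (L : ℕ), E ∈ 𝔭 → E ≠ 0 → E.IsHomogeneous L → 1 ≤ L →
      (∀ P ∈ 𝔭, P ≠ 0 → ∀ d, P.IsHomogeneous d → L ≤ d) → ∃ j ≤ N, (homT ℚ)^[j] E ∉ 𝔭 := by
  obtain ⟨N₁, β₁, κ₁, A₁, -, h₁⟩ := chain_iterate 1 (by norm_num)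
  obtain ⟨N₂, β₂, κ₂, A₂, -, h₂⟩ := chain_iterate 2 (by norm_num)
  obtain ⟨N₃, β₃, κ₃, A₃, -, h₃⟩ := chain_iterate 3 le_rfl
  refine ⟨max N₁ (max N₂ N₃), fun r 𝔭 hr2 hr4 hprime hhom hunm hdeep E L hE hE0 hEL hL hmin => ?_⟩
  by_contra hcon
  push Not at hcon
  have hr1 : 1 ≤ r := by omega
  have hdeg1 : 1 ≤ ideg 𝔭 r :=
    one_le_ideg_of_isPrime NesterenkoPhilippon2001_ch3_prop_4_4_holds hr1 hr4 hprime hhom hunm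
  have hord1 : 1 ≤ ordI 𝔭 r := by
    refine le_trans ?_ hdeep
    have : 1 ≤ 3 * r * ideg 𝔭 r := Nat.one_le_iff_ne_zero.mpr (Nat.mul_ne_zero (by omega) (by omega))
    exact_mod_cast this
  have hx0 := X_zero_notMem_of_one_le_ordI hr1 hr4 hprime hhom hunm hord1
  interval_cases r
  · obtain ⟨Es, hlen, hmem, -, -, -, hav, -⟩ := h₃ 2 𝔭 hr1 hr4 hprime hhom hunm hdeep hx0 E L hE hE0 hEL hL
      hmin _ ((le_max_right _ _).trans (le_max_right _ _)) hcon
    exact false_of_chain_length le_rfl hprime hunm hlen hmem hav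
  · obtain ⟨Es, hlen, hmem, -, -, -, hav, -⟩ := h₂ 3 𝔭 hr1 hr4 hprime hhom hunm hdeep hx0 E L hE hE0 hEL hL
      hmin _ ((le_max_left _ _).trans (le_max_right _ _)) hcon
    exact false_of_chain_length (by norm_num) hprime hunm hlen hmem hav
  · obtain ⟨Es, hlen, hmem, -, -, -, hav, -⟩ := h₁ 4 𝔭 hr1 hr4 hprime hhom hunm hdeep hx0 E L hE hE0 hEL hL
      hmin _ (le_max_left _ _) hcon
    exact false_of_chain_length (by norm_num) hprime hunm hlen hmem hav

/-! ### Proposition 3.6 (projectivised) and the barrier -/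

/-- **Proposition 3.6 of LNM 1752 Ch. 10, projectivised over `ℚ`, at levels `2 ≤ r ≤ 4`** (the
hypothesis `P36` of `nesterenkoModularScope_of_prop36`): for every homogeneous prime
`𝔭 ⊂ ℚ[x₀, …, x₄]` of rank `r` with `ord 𝔭 ≥ 3 r deg 𝔭` there are forms `A ∈ 𝔭`, `B ∉ 𝔭` with
`1 ≤ deg B ≤ λ (deg 𝔭)^{1/(5−r)}` and `ord A(ω̂) < ord B(ω̂)`. As printed: `E` a least form of `𝔭`
(`deg E ≤ γ (deg 𝔭)^{1/(5−r)}` by Cor. 3.3), `A = Tⁱ E ∈ 𝔭` with `C = TA ∉ 𝔭` and `i` bounded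
(`exists_homT_iterate_notMem`), `B = C²`; `ord C ≥ ord A ≥ 1` by (67) and the depth of `𝔭`.
[cite: NesterenkoPhilippon2001, Ch. 10 Prop. 3.6 (pp. 157–159), (66)–(68)] -/
theorem prop36 : ∃ lam : ℝ, 0 ≤ lam ∧ ∀ r : ℕ, 2 ≤ r → r ≤ 4 → ∀ 𝔭 : Ideal (Rx 4), 𝔭.IsPrime →
      𝔭.IsHomogeneous (homogeneousSubmodule (Fin 5) ℚ) → IsUnmixedOfRank 𝔭 r →
      ((3 * r * ideg 𝔭 r : ℕ) : ℕ∞) ≤ ordI 𝔭 r →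
      ∃ (A B : Rx 4) (a d : ℕ), A ∈ 𝔭 ∧ A.IsHomogeneous a ∧ B ∉ 𝔭 ∧ B.IsHomogeneous d ∧ 1 ≤ d ∧
        (d : ℝ) ≤ lam * (ideg 𝔭 r : ℝ) ^ (1 / (5 - r : ℝ)) ∧ ordAlongQ A < ordAlongQ B := by
  classical
  obtain ⟨N, hN⟩ := exists_homT_iterate_notMem
  refine ⟨2 * (N + 1) * 648, by positivity, fun r hr2 hr4 𝔭 hprime hhom hunm hdeep => ?_⟩
  have hr1 : 1 ≤ r := by omega
  have hdeg1 : 1 ≤ ideg 𝔭 r :=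
    one_le_ideg_of_isPrime NesterenkoPhilippon2001_ch3_prop_4_4_holds hr1 hr4 hprime hhom hunm
  have hord1 : 1 ≤ ordI 𝔭 r := by
    refine le_trans ?_ hdeep
    have : 1 ≤ 3 * r * ideg 𝔭 r := Nat.one_le_iff_ne_zero.mpr (Nat.mul_ne_zero (by omega) (by omega))
    exact_mod_cast this
  have hx0 := X_zero_notMem_of_one_le_ordI hr1 hr4 hprime hhom hunm hord1
  obtain ⟨E, L, hE, hE0, hEL, hL, hmin⟩ :=
    exists_isLeastForm hhom (ne_bot_of_isPrime_of_rank_le hprime hunm hr4) hprime.ne_top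
  -- `L ≤ 648 (deg 𝔭)^{1/(5-r)}` (Cor. 3.3 over the constant field, `s = r - 1`)
  have hdim : ringKrullDim (Rx 4 ⧸ 𝔭) = ((r - 1) + 1 : ℕ) := by
    rw [Nat.sub_add_cancel hr1]; exact hunm.2 𝔭 (self_mem_associatedPrimes hprime)
  obtain ⟨P, ν, hP, hPν, hP0, hνle⟩ :=
    exists_form_degree_le_rpow_of_isPrime (m := 4) hprime hhom (s := r - 1) (by omega) hdim hx0
  have hLν : L ≤ ν := hmin P hP hP0 ν hPν
  have hX : (0 : ℝ) ≤ (ideg 𝔭 r : ℝ) ^ (1 / (5 - r : ℝ)) := Real.rpow_nonneg (Nat.cast_nonneg _) _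
  have hLreal : (L : ℝ) ≤ 648 * (ideg 𝔭 r : ℝ) ^ (1 / (5 - r : ℝ)) := by
    have hc : ((Nat.factorial 4 * (r - 1) ^ (r - 1) : ℕ) : ℝ) ≤ 648 := by
      have : Nat.factorial 4 * (r - 1) ^ (r - 1) ≤ 648 := by
        interval_cases r <;> decide
      exact_mod_cast this
    have hexp : (1 / ((4 : ℕ) - ((r - 1 : ℕ) : ℝ)) : ℝ) = 1 / (5 - r : ℝ) := by
      rw [Nat.cast_sub hr1]; push_cast; ring
    rw [Nat.sub_add_cancel hr1, hexp] at hνle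
    calc (L : ℝ) ≤ ν := by exact_mod_cast hLν
      _ ≤ _ := hνle
      _ ≤ 648 * (ideg 𝔭 r : ℝ) ^ (1 / (5 - r : ℝ)) := mul_le_mul_of_nonneg_right hc hX
  -- the `T`-orbit leaves `𝔭`: least exit time `j₀ ≥ 1`
  obtain ⟨j, hjN, hj⟩ := hN r 𝔭 hr2 hr4 hprime hhom hunm hdeep E L hE hE0 hEL hL hmin
  have hexj : ∃ j, (homT ℚ)^[j] E ∉ 𝔭 := ⟨j, hj⟩
  obtain ⟨j₀, hj₀⟩ : ∃ j₀, j₀ = Nat.find hexj := ⟨_, rfl⟩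
  have hj₀spec : (homT ℚ)^[j₀] E ∉ 𝔭 := hj₀ ▸ Nat.find_spec hexj
  have hj₀le : j₀ ≤ j := hj₀ ▸ Nat.find_min' hexj hj
  have hj₀pos : 0 < j₀ := by
    by_contra h0
    have : j₀ = 0 := by omega
    rw [this] at hj₀spec
    exact hj₀spec hE
  obtain ⟨i, hi⟩ : ∃ i, j₀ = i + 1 := ⟨j₀ - 1, by omega⟩
  have hA : (homT ℚ)^[i] E ∈ 𝔭 := by
    have := Nat.find_min hexj (m := i) (by omega)
    push Not at this
    exact this
  have hC : homT ℚ ((homT ℚ)^[i] E) ∉ 𝔭 := by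
    have e : (homT ℚ)^[i + 1] E = homT ℚ ((homT ℚ)^[i] E) := Function.iterate_succ_apply' _ _ _
    rw [← e, ← hi]; exact hj₀spec
  have hAhom : ((homT ℚ)^[i] E).IsHomogeneous (L + i) := isHomogeneous_homT_iterate ℚ hEL i
  have hChom : (homT ℚ ((homT ℚ)^[i] E)).IsHomogeneous (L + i + 1) := isHomogeneous_homT ℚ hAhom
  refine ⟨(homT ℚ)^[i] E, (homT ℚ ((homT ℚ)^[i] E)) ^ 2, L + i, (L + i + 1) * 2, hA, hAhom,
    fun h => hC (hprime.mem_of_pow_mem 2 h), hChom.pow 2, by omega, ?_, ?_⟩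
  · -- the degree of `B`
    have h1 : (((L + i + 1) * 2 : ℕ) : ℝ) ≤ 2 * (N + 1) * L := by
      have : (L + i + 1) * 2 ≤ 2 * (N + 1) * L := by nlinarith
      exact_mod_cast this
    calc (((L + i + 1) * 2 : ℕ) : ℝ) ≤ 2 * (N + 1) * L := h1
      _ ≤ 2 * (N + 1) * (648 * (ideg 𝔭 r : ℝ) ^ (1 / (5 - r : ℝ))) :=
          mul_le_mul_of_nonneg_left hLreal (by positivity)
      _ = 2 * (N + 1) * 648 * (ideg 𝔭 r : ℝ) ^ (1 / (5 - r : ℝ)) := by ring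
  · -- `ord A < ord B = 2 ord C`, as `1 ≤ ord A ≤ ord C` and `ord A < ∞`
    have hA0 : (homT ℚ)^[i] E ≠ 0 := fun h => hC (by rw [h, map_zero]; exact 𝔭.zero_mem)
    obtain ⟨v, hv⟩ := ENat.ne_top_iff_exists.mp (ordAlongQ_ne_top_of_isHomogeneous hAhom hA0)
    have hv1 : 1 ≤ v := by
      have h := ordI_le_of_mem_of_ordAlongQ_eq hr1 hr4 hprime hhom hunm hA hAhom hv.symm
      by_contra h0
      have hv0 : v = 0 := by omega
      rw [hv0, mul_zero, Nat.cast_zero, nonpos_iff_eq_zero] at h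
      rw [h] at hord1
      exact absurd hord1 (by decide)
    have hAC : ordAlongQ ((homT ℚ)^[i] E) ≤ ordAlongQ (homT ℚ ((homT ℚ)^[i] E)) := by
      simpa using ordAlongQ_le_ordAlongQ_homT_iterate ((homT ℚ)^[i] E) 1
    rw [ordAlongQ_pow]
    rw [← hv] at hAC ⊢
    calc (v : ℕ∞) < ((2 * v : ℕ) : ℕ∞) := by exact_mod_cast (show v < 2 * v by omega)
      _ = 2 • (v : ℕ∞) := by rw [Nat.cast_mul, nsmul_eq_mul, Nat.cast_ofNat]
      _ ≤ 2 • ordAlongQ (homT ℚ ((homT ℚ)^[i] E)) := nsmul_le_nsmul_right hAC 2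

end Transfer

/-- **Nesterenko's theorem (1996), LNM 1752 Ch. 3 Theorem 1.1 — the barrier declaration
`NesterenkoModularScope`, discharged**: for `0 < |q| < 1`, `trdeg_ℚ ℚ(q, P(q), Q(q), R(q)) ≥ 3`.
The tree's proof follows the "other proof" of Ch. 3 §§4–5 with the multiplicity estimate of
Ch. 10 projectivised over `ℚ` (`Transfer.nesterenkoModularScope_of_prop36`: Props. 4.4, 4.7, 4.8,
4.11, 4.13 and Cors. 4.9, 4.10 of Ch. 3, the Ramanujan system, Mahler's algebraic independence of
`z, P, Q, R` over `ℂ(z)`-free form, the `D`-property Prop. 5.1 of Ch. 10, all proved in the tree),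
completed here by Proposition 3.6 of Ch. 10 (`Transfer.prop36`).
[cite: NesterenkoPhilippon2001, Ch. 3 Theorem 1.1 (p. 27); Ch. 10 Prop. 3.6 (p. 157), §4 (pp. 161–162)]
[cite: Nesterenko1996SbMath, Theorem 1] -/
theorem NesterenkoModularScope_holds : NesterenkoModularScope := by
  obtain ⟨lam, hlam, h36⟩ := Transfer.prop36
  exact Transfer.nesterenkoModularScope_of_prop36 hlam h36

/-- The same statement under its other name in the tree, `nesterenko1996_thm_1_1`
(`NesterenkoModularScope := nesterenko1996_thm_1_1`). [cite: NesterenkoPhilippon2001, Ch. 3 Theorem 1.1 (p. 27)] -/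
theorem nesterenko1996_thm_1_1_holds : nesterenko1996_thm_1_1 :=
  NesterenkoModularScope_holds

end Literature.Barriers.Schanuel

end
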